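import Mathlib
import Summits.ValiantsHypothesis.ValiantsHypothesis.Theorems.FifoMatchingNNDivisionHardFewSummandsUnion
import Summits.ValiantsHypothesis.ValiantsHypothesis.Theorems.FifoMatchingNNDivisionHardLocalization
import HarnessLib

/-!
# The FEW-SUMMANDS classes as BINDERS for line `virtual_passenger`'s research stub (crux `Theses.FifoMatching.NNDivisionHard`,
# stmt-ValiantsHypothesis-21181) — the by-name hooks, in the shape of the line's `zonoBlind_decided`

The line's `CoreLaw…` binders come in two kinds: `c`-FREE classes (disjuncts of `ConeD`, glued by `Localization.decided_or`; leafhand-8-g2's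
`fewFlats_decided` is one) and `c`-DEPENDENT located classes entered as separate binders with a theorem of the shape
`∀ c, ∃ h₀, ∀ h ≥ h₀, ∀ K q r, CLASS c h q → HasEFOfSize (COR(K_h) + conv q) r → T c h < r` (the line's `zonoBlind_decided`).  The FEW-SUMMANDS
LAW (✓ `…FewSummandsLaw.summands_decided`) and its union form (✓ `…FewSummandsUnion.union_summands_decided`) are of the second kind (their level
`m' = 2(log₂h+c)^c+4` depends on `c`).  This file states them in exactly the binder shape, with the class written as a lambda over the line's
currency `q : Fin (K+1) → ℝ^{h×h}` («`range q` IS a product family / a union of product families with the count condition at level `c`»):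

* ★ `summandsLocated_decided` — binder form of the few-summands law;
* ★ `unionSummandsLocated_decided` — binder form of the union law.

No definitions, no named facts, no sorry.  HONEST FRAMING: by-name hooks for the pen; `stub_coreLaw` / COR-VIRTUAL / stmt-21181 OPEN; `VP ≠ VNP`
NOT proved.  [cite: KaibelWeltge2014, Thm. 1]
-/

set_option autoImplicit false

-- the mandated summit-side namespace repeats a component by design (single-problem summit)
set_option linter.dupNamespace false

noncomputable section

open Matrix Finset
open scoped Pointwise

namespace Summit.ValiantsHypothesis.ValiantsHypothesis.Theorems.FifoMatching

namespace Summands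

open Literature.Barriers.PneNP (HasEFOfSize)
open Literature.Combinatorics.Optimization (corPolytopeGraph)
open Summit.ValiantsHypothesis.ValiantsHypothesis.Theorems.FifoMatching.Localization (Fam T)

/-- ★ **BINDER FORM OF THE FEW-SUMMANDS LAW:** for every `c` (threshold `h₀ = 0`): if `range q` is a product family with `M` summands of
`m ≥ 1` listed points and, for some `t ≥ 1` with `(2(log₂h+c)^c+4)·t ≤ h`, `(M·m²)·C(h−t−1,t−1) < C(h−1,t−1)`, then every size-`r` extended
formulation of `COR(K_h) + conv q` has `T c h < r`. [cite: KaibelWeltge2014, Thm. 1] -/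
theorem summandsLocated_decided (c : ℕ) : ∃ h₀ : ℕ, ∀ h ≥ h₀, ∀ (K : ℕ) (q : Fam h K) (r : ℕ),
    (∃ (M m t : ℕ) (vtx : Fin M → Fin m → (Fin h × Fin h → ℝ)) (w : Fin h × Fin h → ℝ),
      1 ≤ m ∧ 1 ≤ t ∧ (2 * (Nat.log 2 h + c) ^ c + 4) * t ≤ h ∧
      (M * (m * m)) * Nat.choose (h - t - 1) (t - 1) < Nat.choose (h - 1) (t - 1) ∧
      Set.range q = Set.range (fun f : Fin M → Fin m => w + ∑ i, vtx i (f i))) →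
    HasEFOfSize (corPolytopeGraph (⊤ : SimpleGraph (Fin h)) + convexHull ℝ (Set.range q)) r → T c h < r := by
  refine ⟨0, fun h _ K q r hX hEF => ?_⟩
  obtain ⟨M, m, t, vtx, w, hm, ht, hh, hcount, hrange⟩ := hX
  rw [hrange] at hEF
  exact summands_decided c h t M m vtx w r ht hm hh hcount hEF

/-- ★ **BINDER FORM OF THE UNION LAW:** the same for `range q` a union of `K' ≥ 1` product families with `2K'·8^L ≤ 9^L`, `L = (log₂h+c)^c`.
[cite: KaibelWeltge2014, Thm. 1] -/
theorem unionSummandsLocated_decided (c : ℕ) : ∃ h₀ : ℕ, ∀ h ≥ h₀, ∀ (K : ℕ) (q : Fam h K) (r : ℕ),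
    (∃ (K' M m t : ℕ) (vtx : Fin K' → Fin M → Fin m → (Fin h × Fin h → ℝ)) (w : Fin K' → (Fin h × Fin h → ℝ)),
      1 ≤ K' ∧ 1 ≤ m ∧ 1 ≤ t ∧ 2 * K' * 8 ^ ((Nat.log 2 h + c) ^ c) ≤ 9 ^ ((Nat.log 2 h + c) ^ c) ∧
      (2 * (Nat.log 2 h + c) ^ c + 4) * t ≤ h ∧
      (K' * (M * (m * m))) * Nat.choose (h - t - 1) (t - 1) < Nat.choose (h - 1) (t - 1) ∧
      Set.range q = Set.range (fun kf : Fin K' × (Fin M → Fin m) => w kf.1 + ∑ i, vtx kf.1 i (kf.2 i))) →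
    HasEFOfSize (corPolytopeGraph (⊤ : SimpleGraph (Fin h)) + convexHull ℝ (Set.range q)) r → T c h < r := by
  refine ⟨0, fun h _ K q r hX hEF => ?_⟩
  obtain ⟨K', M, m, t, vtx, w, hK, hm, ht, hKL, hh, hcount, hrange⟩ := hX
  rw [hrange] at hEF
  exact union_summands_decided c h t K' M m vtx w r ht hK hm hKL hh hcount hEF

end Summands

end Summit.ValiantsHypothesis.ValiantsHypothesis.Theorems.FifoMatching

end
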